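import Summits.Ventures.PercRepro.RLSRuleLinePointGeom
import Summits.Ventures.PercRepro.RLSZeroWorld

/-!
# PercRepro — `R₃⁺` at `t = 0` on the plane «`3`-point line + point»: the first loss case (L3) in the kernel
(night-3, gen 3)

The `t = 0, P₂` half of the lane on the smallest plane WITH a `3`-point line, `G = ℓ ∪ {a}`, for every `p ≥ 8`: its
three independent triples pay `Φ(p, 3)` each (`wPlus_union_ge_of_triple`), and `G` itself pays `Φ(p, 3)` despite the
loss case (L3) — a witness `X ⊆ K` containing the (at most one) triple of `K` coplanar with `ℓ` gives `G` nothing,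
every other witness gives `3 / C(4 + |X|, 3)` (`wPlus_union_ge_of_good`); the lost witnesses number `C(p − 3, x − 3)`
at level `x` (`sum_lost_eq`: they add up to `3 · lost4Sum n`), and the lane's kernel bound `U0.zero_l3four`
(`RLSZeroWorld`) says `3(z₁ − lost₄) ≥ Φ(p, 3)`.  The demand is at most `4` (`card_UqG_three_line_point_le`).

* **`perFlat_three_line_point`** — `Φ(p, 3) · #U_G ≤ Σ_{S ∈ Yq} w⁺(G, S)` for `G = ℓ ∪ {a}` of type `0`
  (`ρ(E ∖ G) ≥ p`) and every `p ≥ 8`, on a matroid simple on `G`.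
Imports `RLSRuleLinePointGeom`, `RLSZeroWorld`.  Axioms: standard.
-/

open scoped Matroid

namespace PercRepro

namespace NightThree

open Finset ThmH PerFlat

variable {α : Type*} [DecidableEq α] {M : Matroid α} [M.Finite]

/-! ### The lost witnesses -/

/-- **The lost share.**  For `|K| = n + 4` and a `3`-subset `C ⊆ K`,
`Σ_{X ∈ W, C ⊆ X} 3 / C(4 + |X|, 3) = 3 · lost4Sum n`. -/
theorem sum_lost_eq {K C : Finset α} {n : ℕ} (hn : 2 ≤ n) (hK : K.card = n + 4) (hC : C ⊆ K)
    (hCc : C.card = 3) :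
    ∑ X ∈ (witnessFamily K n).filter (fun X => C ⊆ X), 3 / (((4 + X.card).choose 3 : ℕ) : ℚ) =
      3 * U0.lost4Sum n := by
  classical
  unfold witnessFamily
  rw [Finset.filter_biUnion, Finset.sum_biUnion]
  · have hinner : ∀ x ∈ Finset.Ico 1 (n + 1),
        ∑ X ∈ (K.powersetCard x).filter (fun X => C ⊆ X), 3 / (((4 + X.card).choose 3 : ℕ) : ℚ) =
          if 3 ≤ x then ((n + 1).choose (x - 3) : ℚ) * (3 / (((4 + x).choose 3 : ℕ) : ℚ)) else 0 := by
      intro x _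
      rw [Finset.sum_congr rfl (fun X hX => by
        rw [(Finset.mem_powersetCard.1 (Finset.mem_filter.1 hX).1).2]), Finset.sum_const, nsmul_eq_mul]
      by_cases h3 : 3 ≤ x
      · rw [if_pos h3, card_filter_subset_powersetCard hC hCc h3, hK, show n + 4 - 3 = n + 1 by omega]
      · rw [if_neg h3]
        have : ((K.powersetCard x).filter (fun X => C ⊆ X)) = ∅ := by
          rw [Finset.eq_empty_iff_forall_notMem]
          intro X hX
          rw [Finset.mem_filter, Finset.mem_powersetCard] at hX
          have := Finset.card_le_card hX.2
          omega
        rw [this, Finset.card_empty, Nat.cast_zero, zero_mul]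
    rw [Finset.sum_congr rfl hinner]
    rw [← Finset.sum_Ico_consecutive _ (show 1 ≤ 3 by norm_num) (show 3 ≤ n + 1 by omega)]
    have hz : ∑ x ∈ Finset.Ico 1 3, (if 3 ≤ x then ((n + 1).choose (x - 3) : ℚ) *
        (3 / (((4 + x).choose 3 : ℕ) : ℚ)) else 0) = 0 := by
      apply Finset.sum_eq_zero
      intro x hx
      rw [Finset.mem_Ico] at hx
      rw [if_neg (by omega)]
    rw [hz, zero_add, Finset.sum_Ico_eq_sum_range, show n + 1 - 3 = n - 2 by omega]
    unfold U0.lost4Sum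
    rw [Finset.mul_sum]
    apply Finset.sum_congr rfl
    intro j _
    rw [if_pos (by omega), show 3 + j - 3 = j by omega, show 4 + (3 + j) = j + 7 by omega]
    ring
  · exact (K.pairwise_disjoint_powersetCard.set_pairwise _).mono' (fun x y h => by
      exact Finset.disjoint_filter_filter h)

/-- The demand of `G = ℓ ∪ {a}` is at most `4` (the four rank-`3` subsets: three triples and `G`). -/
theorem card_UqG_three_line_point_le {G ℓ : Finset α} (hℓG : ℓ ⊆ G) (hℓr : M.eRk (ℓ : Set α) = 2)
    (hℓc : ℓ.card = 3) (hGc : G.card = 4) (p : ℕ) : (UqG M p 3 G).card ≤ 4 := by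
  classical
  have hsub : UqG M p 3 G ⊆ (G.powerset.filter (fun B => 3 ≤ B.card)).erase ℓ := by
    intro B hB
    unfold UqG at hB
    rw [Finset.mem_filter, mem_Uq] at hB
    obtain ⟨⟨_, hB3, _⟩, hBG⟩ := hB
    have hB3' : M.eRk (B : Set α) = 3 := by exact_mod_cast hB3
    rw [Finset.mem_erase, Finset.mem_filter, Finset.mem_powerset]
    refine ⟨?_, hBG, three_le_card_of_eRk_eq_three hB3'⟩
    rintro rfl
    rw [hℓr] at hB3'
    exact absurd hB3' (by norm_num)
  have hcard : ((G.powerset.filter (fun B => 3 ≤ B.card)).erase ℓ).card = 4 := by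
    rw [Finset.card_erase_of_mem (by
      rw [Finset.mem_filter, Finset.mem_powerset]; exact ⟨hℓG, by omega⟩)]
    have : (G.powerset.filter (fun B => 3 ≤ B.card)).card = 5 := by
      have h := Finset.card_filter (fun B : Finset α => 3 ≤ B.card) G.powerset
      rw [h, Finset.sum_powerset_apply_card (fun b => if 3 ≤ b then 1 else 0), hGc]
      norm_num [Finset.sum_range_succ, Nat.choose]
    rw [this]
  calc (UqG M p 3 G).card ≤ ((G.powerset.filter (fun B => 3 ≤ B.card)).erase ℓ).card :=
        Finset.card_le_card hsub
    _ = 4 := hcard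

open scoped Classical in
/-- **`R₃⁺` at `t = 0` on the plane `ℓ ∪ {a}`**, every `p ≥ 8`: on a matroid simple on `G`, with `ρ(E ∖ G) ≥ p`,
`Φ(p, 3) · #U_G ≤ Σ_{S ∈ Yq} w⁺(G, S)`. -/
theorem perFlat_three_line_point {G ℓ : Finset α} (hG : G ∈ flatsQ M 3) (hℓG : ℓ ⊆ G)
    (hℓr : M.eRk (ℓ : Set α) = 2) (hℓc : ℓ.card = 3) (hGc : G.card = 4) (hsimple : SimpleOn M G) {n : ℕ}
    (hn : 4 ≤ n) (hK : ((n + 4 : ℕ) : ℕ∞) ≤ M.eRk ((gr M \ G : Finset α) : Set α)) :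
    phiK (n + 4) 3 * ((UqG M (n + 4) 3 G).card : ℚ) ≤ ∑ S ∈ Yq M (n + 4) 3, wPlus M G S := by
  obtain ⟨K, hKsub, hKind, hKcard⟩ := exists_indep_compl_card G hK
  have hKG : Disjoint K G := by
    rw [Finset.disjoint_left]
    intro x hxK hxG
    have := hKsub hxK
    rw [Finset.mem_sdiff] at this
    exact this.2 hxG
  have hGE : G ⊆ gr M := (mem_flatsQ.1 hG).1
  have hG3 : M.eRk (G : Set α) = 3 := eRk_eq_three_of_mem_flatsQ' hG
  -- the family: the three independent triples and `G`
  set 𝒯 : Finset (Finset α) := (G.powersetCard 3).erase ℓ with h𝒯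
  have hGnot : G ∉ 𝒯 := by
    rw [h𝒯, Finset.mem_erase, Finset.mem_powersetCard]
    rintro ⟨_, _, h⟩
    omega
  have h𝒯card : 𝒯.card = 3 := by
    rw [h𝒯, Finset.card_erase_of_mem (Finset.mem_powersetCard.2 ⟨hℓG, hℓc⟩), Finset.card_powersetCard, hGc]
    rfl
  have h𝒯mem : ∀ T ∈ 𝒯, T ⊆ G ∧ M.Indep (T : Set α) ∧ T.card = 3 := by
    intro T hT
    rw [h𝒯, Finset.mem_erase, Finset.mem_powersetCard] at hT
    exact ⟨hT.2.1, indep_of_ne_line hG hℓG hℓr hℓc hGc hsimple hT.2.1 hT.2.2 hT.1, hT.2.2⟩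
  set f : Finset α → Finset α → ℚ := fun B X =>
    if B = G then (if GoodWitness M ℓ K X then 3 / (((4 + X.card).choose 3 : ℕ) : ℚ) else 0)
    else 1 / (((3 + X.card).choose 3 : ℕ) : ℚ) with hf
  have hfG : ∀ X, f G X = (if GoodWitness M ℓ K X then 3 / (((4 + X.card).choose 3 : ℕ) : ℚ) else 0) := by
    intro X
    rw [hf]
    dsimp only
    rw [if_pos rfl]
  have hfT : ∀ B ∈ 𝒯, ∀ X, f B X = 1 / (((3 + X.card).choose 3 : ℕ) : ℚ) := by
    intro B hB X
    rw [hf]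
    dsimp only
    rw [if_neg (fun (h : B = G) => hGnot (h ▸ hB))]
  have hsup := supply_ge_of_family hG (𝔅 := insert G 𝒯) (fun B hB => by
      rcases Finset.mem_insert.1 hB with rfl | hB
      · exact ⟨le_rfl, hG3⟩
      · obtain ⟨hTG, hTind, hTc⟩ := h𝒯mem B hB
        exact ⟨hTG, eRk_eq_three_of_indep_card hTind hTc⟩) hKsub hKind n f (fun B hB X hX => by
      obtain ⟨hXK, _, _⟩ := mem_witnessFamily hX
      have hXind : M.Indep (X : Set α) := hKind.subset (Finset.coe_subset.2 hXK)
      have hXG : Disjoint X G := Finset.disjoint_of_subset_left hXK hKG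
      rcases Finset.mem_insert.1 hB with rfl | hB
      · rw [hfG]
        by_cases hgood : GoodWitness M ℓ K X
        · rw [if_pos hgood]
          exact wPlus_union_ge_of_good hG hℓG hℓr hℓc hGc hsimple hXind hXG hXK hgood
        · rw [if_neg hgood]
          exact wPlus_nonneg M B (B ∪ X)
      · rw [hfT B hB]
        obtain ⟨hTG, hTind, hTc⟩ := h𝒯mem B hB
        exact wPlus_union_ge_of_triple hG hsimple hTG hTind hTc hXind hXG)
  rw [Finset.sum_insert hGnot] at hsup
  -- the triples pay `3Φ`
  have htriples : ∑ B ∈ 𝒯, ∑ X ∈ witnessFamily K n, f B X = 3 * phiK (n + 4) 3 := by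
    rw [Finset.sum_congr rfl (fun B hB => Finset.sum_congr rfl (fun X _ => hfT B hB X)),
      Finset.sum_congr rfl (fun B _ => sum_witness_eq_phiK hKcard), Finset.sum_const, h𝒯card, nsmul_eq_mul]
    norm_num
  -- `G` pays `3(z₁ − lost₄) ≥ Φ`
  have hGpays : phiK (n + 4) 3 ≤ ∑ X ∈ witnessFamily K n, f G X := by
    rw [Finset.sum_congr rfl (fun X _ => hfG X), ← Finset.sum_filter]
    -- the full sum is `3 z₁`
    have hfull : ∑ X ∈ witnessFamily K n, 3 / (((4 + X.card).choose 3 : ℕ) : ℚ) = 3 * U0.z1Sum n := by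
      rw [sum_witnessFamily K n (fun x => 3 / (((4 + x).choose 3 : ℕ) : ℚ)), hKcard]
      unfold U0.z1Sum
      rw [Finset.mul_sum]
      apply Finset.sum_congr rfl
      intro i _
      rw [show 4 + (i + 1) = i + 5 by omega]
      ring
    have hkey := U0.zero_l3four n hn
    have hphi : phiK (n + 4) 3 = ∑ i ∈ range n, ((n + 4).choose (i + 1) : ℚ) / ((i + 4).choose 3 : ℚ) := by
      unfold phiK
      rw [phiW_eq_phiK_form n]
      rfl
    rw [← hphi] at hkey
    -- the bad witnesses contain the (unique) coplanar triple
    have hsplit : ∑ X ∈ (witnessFamily K n).filter (fun X => GoodWitness M ℓ K X),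
        3 / (((4 + X.card).choose 3 : ℕ) : ℚ) =
        ∑ X ∈ witnessFamily K n, 3 / (((4 + X.card).choose 3 : ℕ) : ℚ) -
          ∑ X ∈ (witnessFamily K n).filter (fun X => ¬ GoodWitness M ℓ K X),
            3 / (((4 + X.card).choose 3 : ℕ) : ℚ) := by
      rw [eq_sub_iff_add_eq, Finset.sum_filter_add_sum_filter_not]
    have hbad : ∑ X ∈ (witnessFamily K n).filter (fun X => ¬ GoodWitness M ℓ K X),
        3 / (((4 + X.card).choose 3 : ℕ) : ℚ) ≤ 3 * U0.lost4Sum n := by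
      have hlost_nonneg : 0 ≤ U0.lost4Sum n := by
        unfold U0.lost4Sum
        exact Finset.sum_nonneg (fun j _ => by positivity)
      have hℓE : ℓ ⊆ gr M := hℓG.trans hGE
      have hoff : ∀ y ∈ K, y ∉ M.closure (ℓ : Set α) := by
        intro y hyK hy
        have hGflat : M.IsFlat (G : Set α) := (mem_flatsQ.1 hG).2.1
        have : y ∈ (G : Set α) := by
          have := M.closure_subset_closure (Finset.coe_subset.2 hℓG) hy
          rwa [hGflat.closure] at this
        exact Finset.disjoint_left.1 hKG hyK (Finset.mem_coe.1 this)
      have hle1 := card_coplanar_triples_le_one hℓr hℓE hKind hoff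
      rcases Finset.eq_empty_or_nonempty (coplanarTriples M ℓ K) with hemp | ⟨C, hC⟩
      · -- no coplanar triple: every witness is good
        have : (witnessFamily K n).filter (fun X => ¬ GoodWitness M ℓ K X) = ∅ := by
          rw [Finset.eq_empty_iff_forall_notMem]
          intro X hX
          rw [Finset.mem_filter] at hX
          apply hX.2
          intro C hC
          unfold coplanarTriples at hC hemp
          rw [hemp] at hC
          exact absurd hC (Finset.notMem_empty C)
        rw [this, Finset.sum_empty]
        positivity
      · -- exactly one coplanar triple `C`: bad = `C ⊆ X`
        have huniq : ∀ C' ∈ coplanarTriples M ℓ K, C' = C := by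
          intro C' hC'
          unfold coplanarTriples at hC hC' hle1
          exact Finset.card_le_one.1 hle1 C' hC' C hC
        have hCK : C ⊆ K := by
          unfold coplanarTriples at hC
          exact (Finset.mem_powersetCard.1 (Finset.mem_filter.1 hC).1).1
        have hCc : C.card = 3 := by
          unfold coplanarTriples at hC
          exact (Finset.mem_powersetCard.1 (Finset.mem_filter.1 hC).1).2
        have hfilt : (witnessFamily K n).filter (fun X => ¬ GoodWitness M ℓ K X) =
            (witnessFamily K n).filter (fun X => C ⊆ X) := by
          ext X
          rw [Finset.mem_filter, Finset.mem_filter]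
          constructor
          · rintro ⟨hX, hbad⟩
            refine ⟨hX, ?_⟩
            by_contra hCX
            apply hbad
            intro C' hC'
            rw [huniq C' hC']
            exact hCX
          · rintro ⟨hX, hCX⟩
            exact ⟨hX, fun hgood => hgood C hC hCX⟩
        rw [hfilt, sum_lost_eq (by omega) hKcard hCK hCc]
    rw [hsplit, hfull]
    linarith
  have hdem : ((UqG M (n + 4) 3 G).card : ℚ) ≤ 4 := by
    exact_mod_cast card_UqG_three_line_point_le hℓG hℓr hℓc hGc (n + 4)
  calc phiK (n + 4) 3 * ((UqG M (n + 4) 3 G).card : ℚ)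
      ≤ phiK (n + 4) 3 * 4 := mul_le_mul_of_nonneg_left hdem (phiK_nonneg _ _)
    _ = 3 * phiK (n + 4) 3 + phiK (n + 4) 3 := by ring
    _ ≤ ∑ B ∈ 𝒯, ∑ X ∈ witnessFamily K n, f B X + ∑ X ∈ witnessFamily K n, f G X := by
        rw [htriples]
        linarith
    _ = ∑ X ∈ witnessFamily K n, f G X + ∑ B ∈ 𝒯, ∑ X ∈ witnessFamily K n, f B X := add_comm _ _
    _ ≤ ∑ S ∈ Yq M (n + 4) 3, wPlus M G S := hsup

end NightThree

end PercRepro
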